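import Summits.AnomalousDissipation.AnomalousDissipation.Theses.ImpulseGrid
import Literature.Analysis.FluidPDE.TorusClassicalLerayHopfProofs
import Literature.Analysis.FluidPDE.TimeAverageMeasureBasic

/-!
# Route ImpulseGrid (AnomalousDissipation) — the grid sign law on steady branches
(necessary condition; the disprover's target)

Support file for the crux `GridSignsLaw` (item stmt-AnomalousDissipation-14349), line `Sketch`.
A smooth STEADY Navier–Stokes state `u*` (classical solution `(t, x) ↦ u* x` on all of
`ℝ × T³`) is a global Leray–Hopf solution from itself
(`Torus.IsClassicalNSSolutionOn.isGlobalLerayHopf`, Robinson–Rodrigo–Sadowski 2016 Thm. 6.5) with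
constant kinetic energy and constant Cesàro means, so every generalized long-time average of a
slice functional is its value at `u*` (`steady_longTimeAvg_const`) and `meanEnergy = ‖u*‖₂²`
(constant Cesàro means). Feeding constant families into the crux gives the NECESSARY CONDITION
`gridSignsLaw_steady_necessary`: if `GridSignsLaw` holds, then for its design EVERY
vanishing-viscosity sequence of smooth steady states with drift momentum `∫u*ⱼ = c e₀` and
`‖u*ⱼ‖₂² ≤ E` eventually satisfies the two grid signs AT the states: `0 ≤ (G, u*ⱼ)` and
`∫⟪w*ⱼ, (w*ⱼ·∇)(Ψ•G)⟫ ≤ −η`, `w*ⱼ = u*ⱼ − c e₀`, `η > 0` — i.e. the design admits NO bounded quiet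
steady branch (the statement `SteadyGridSigns` of idea card `quiet-core-audit`, here DERIVED from
the crux). Its contrapositive is the cheapest refutation route of the crux: for every design, a
bounded steady branch along which the (b)-functional tends to `0` (or `(G, u*ⱼ) < 0` infinitely
often). The first-moment reading (`0 ≤ (G,u*ⱼ)`, `κ ≤ ((Φ−1)•G,u*ⱼ)`) follows by
`gridSignsLaw_iff_firstMomentLaw` (file `ImpulseGridGridSignsLawFirstMomentForm`).

No new definitions.
-/

noncomputable section

-- `Summit.<Summit>.<Problem>` is the tree's mandated summit-side namespace (CONVENTIONS §2); for this
-- single-conjunct summit the two coincide, so the duplicate is deliberate.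
set_option linter.dupNamespace false

open MeasureTheory Set Filter Topology
open scoped InnerProductSpace RealInnerProductSpace

namespace Summit.AnomalousDissipation.AnomalousDissipation.Theorems

open Literature.Analysis.FluidPDE Literature.Analysis.FluidPDE.Torus
open Literature.Analysis.FunctionSpaces Literature.Analysis.FunctionSpaces.Torus
open Summit.AnomalousDissipation.AnomalousDissipation.Theses.ImpulseGrid

/-- The Cesàro mean over `[0, T]`, `T ≠ 0`, of a constant function is that constant. [folklore] -/
theorem steady_timeMean_const (a : ℝ) {T : ℝ} (hT : T ≠ 0) : timeMean (fun _ => a) T = a := by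
  simp only [timeMean, intervalIntegral.integral_const, sub_zero, smul_eq_mul]
  rw [← mul_assoc, inv_mul_cancel₀ hT, one_mul]

/-- The Cesàro means of a constant function tend to that constant. [folklore] -/
theorem steady_tendsto_timeMean_const (a : ℝ) : Tendsto (timeMean fun _ => a) atTop (𝓝 a) := by
  refine tendsto_const_nhds.congr' ?_
  filter_upwards [eventually_gt_atTop 0] with T hT
  exact (steady_timeMean_const a hT.ne').symm

/-- Every generalized long-time average of a time-independent slice functional is its constant
value (generalized limits extend limits, FMRT 2001 Ch. IV (1.36)). [folklore] -/
theorem steady_longTimeAvg_const (Λ : GeneralizedLimit) (a : ℝ) :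
    Λ.longTimeAvg (fun _ => a) = a :=
  Λ.longTimeAvg_eq_of_tendsto (steady_tendsto_timeMean_const a)

/-- **The grid sign law on steady branches (necessary condition).** If `GridSignsLaw` holds,
then for its design `(Φ, Ψ, G, c)`: for every sequence of viscosities `νⱼ > 0`, `νⱼ → 0`, and
smooth STEADY Navier–Stokes states `u*ⱼ` (classical solutions `(t,x) ↦ u*ⱼ x` with pressures
`p*ⱼ`, force `Φ•G`, viscosity `νⱼ`, on all of `ℝ × T³`) with drift momentum `∫u*ⱼ = c e₀` and
`‖u*ⱼ‖₂² ≤ E`, there are `η > 0` and `J` with, for `j ≥ J`, (a) `0 ≤ (G, u*ⱼ)` and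
(b) `∫⟪u*ⱼ − c e₀, ((u*ⱼ − c e₀)·∇)(Ψ•G)⟫ ≤ −η`. Proof: steady states are global Leray–Hopf
solutions from themselves (`IsClassicalNSSolutionOn.isGlobalLerayHopf`) with constant energy and
constant Cesàro means (`steady_longTimeAvg_const`); apply the crux to
the constant family. Contrapositive: a bounded quiet steady branch of every design refutes the
crux. [folklore] -/
theorem gridSignsLaw_steady_necessary :
    GridSignsLaw → ∃ (Φ Ψ : UnitAddTorus (Fin 3) → ℝ) (G : UnitAddTorus (Fin 3) → EuclideanSpace ℝ (Fin 3))
      (c : ℝ), (IsSmooth Φ ∧ IsSmooth Ψ ∧ IsSmooth G ∧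
        (∀ (s : UnitAddCircle) x, Φ (x + Pi.single (1 : Fin 3) s) = Φ x ∧
          Φ (x + Pi.single (2 : Fin 3) s) = Φ x) ∧
        (∫ x, Φ x = 1) ∧
        (∀ (s : UnitAddCircle) x, Ψ (x + Pi.single (1 : Fin 3) s) = Ψ x ∧
          Ψ (x + Pi.single (2 : Fin 3) s) = Ψ x) ∧
        (∀ (s : UnitAddCircle) x, G (x + Pi.single (0 : Fin 3) s) = G x) ∧ (∀ x, G x 0 = 0) ∧
        IsDivFree G ∧ (∀ x, partialDeriv 0 Ψ x = Φ x - 1) ∧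
        (∫ x, Φ x * Ψ x * ‖G x‖ ^ 2 = 0) ∧
        IsSmooth (fun x => Φ x • G x) ∧ IsDivFree (fun x => Φ x • G x) ∧
        HasZeroMean (fun x => Φ x • G x) ∧ 0 < c) ∧
      ∀ (ν : ℕ → ℝ) (us : ℕ → UnitAddTorus (Fin 3) → EuclideanSpace ℝ (Fin 3))
        (ps : ℕ → UnitAddTorus (Fin 3) → ℝ) (E : ℝ),
        (∀ j, 0 < ν j) → Tendsto ν atTop (𝓝 0) →
        (∀ j, IsClassicalNSSolutionOn univ (ν j) (fun _ => fun x => Φ x • G x) (fun _ => us j)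
          (fun _ => ps j)) →
        (∀ j, ∫ x, us j x = c • EuclideanSpace.single 0 1) →
        (∀ j, ∫ x, ‖us j x‖ ^ 2 ≤ E) →
        ∃ η : ℝ, 0 < η ∧ ∃ J : ℕ, ∀ j, J ≤ j →
          0 ≤ (∫ x, ⟪G x, us j x⟫) ∧
          (∫ x, ⟪us j x - c • EuclideanSpace.single 0 1,
              convect (fun y => us j y - c • EuclideanSpace.single 0 1) (fun y => Ψ y • G y) x⟫)
            ≤ -η := by
  intro h
  obtain ⟨Φ, Ψ, G, c, hΦ, hΨ, hG, hΦinv, hΦmass, hΨinv, hGinv, hG0, hGdiv, hΨderiv, hΦΨG, hfs,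
    hfd, hfm, hc, hlaw⟩ := h
  refine ⟨Φ, Ψ, G, c, ⟨hΦ, hΨ, hG, hΦinv, hΦmass, hΨinv, hGinv, hG0, hGdiv, hΨderiv, hΦΨG, hfs,
    hfd, hfm, hc⟩, ?_⟩
  intro ν us ps E hν hν0 hcl hdrift hE
  -- the constant family is a bounded-energy drift family of global Leray–Hopf solutions
  have hu : ∀ j, IsGlobalLerayHopf (ν j) (fun _ => fun x => Φ x • G x) (us j) (fun _ => us j) :=
    fun j => (hcl j).isGlobalLerayHopf
  have hsup : ∀ j, ∃ C : ℝ, ∀ t : ℝ, 0 ≤ t → kineticEnergy ((fun _ : ℝ => us j) t) ≤ C :=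
    fun j => ⟨kineticEnergy (us j), fun t _ => le_rfl⟩
  -- the mean energy of a steady field is its squared `L²` norm (constant Cesàro means; the same
  -- computation as `RobustLoudUpgrade.SteadyWindow.meanEnergy_const`, inlined to keep imports light)
  have hmean : ∀ j, meanEnergy (fun _ : ℝ => us j) ≤ E := fun j => by
    have hme : meanEnergy (fun _ : ℝ => us j) = ∫ x, ‖us j x‖ ^ 2 := by
      rw [meanEnergy_eq_longTimeAvgSup]
      exact (steady_tendsto_timeMean_const _).limsup_eq
    rw [hme]
    exact hE j
  obtain ⟨η, hη, Λ, J, hJ⟩ := hlaw ν us (fun j _ => us j) E hν hν0 hu hsup hdrift hmean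
  refine ⟨η, hη, J, fun j hj => ?_⟩
  obtain ⟨ha, hb⟩ := hJ j hj
  rw [steady_longTimeAvg_const] at ha hb
  exact ⟨ha, hb⟩

end Summit.AnomalousDissipation.AnomalousDissipation.Theorems

end
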